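import Summits.AtomisticToContinuum.FouriersLaw.Theorems.BondHeatUncertaintyBoundedResponseBathHeatOwedHeatA
import HarnessLib

/-!
# BondHeatUncertainty / BoundedResponse — «OwedHeat» §3–§4: the bath tail functional as ACCUMULATED OWED HEAT, ★★ the late layer cake
`B^late_N(s,t) = γ²(∫_{2s}^{t} 𝒯_N + 2∫_{s}^{2s} 𝒯_N)`, the overshoot bounds `B^late ≥ −2γ²𝒪_N`, `𝒪_N ≤ 𝔐_N`, `𝒪_N² ≤ (t−s)∫𝒯_N²`, the kick-resolved identities
`𝔊^{s,t}_N(k) = ∫_{2s}^{t} 𝔗^v_N(k) dv + 2∫_{s}^{2s} 𝔗^v_N(k) dv`, `𝔊^{0,t₂}_N − 𝔊^{0,t₁}_N = ∫_{t₁}^{t₂} 𝔗^v_N dv`, and the TWO MECHANISMS of the axis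
(decomp-a2c lens-1, g115, NODE 115 «OwedHeat»; part 2 of 4; imports part A; route statements in part C, overview in the main file `…BathHeatOwedHeat`)

§3 (kernel level, `0 < ω₂, λ, β, γ, T`): `K_N` measurable & integrable on `(0,∞)`; `𝒯_N(v) = ∫_{(0,∞)}K_N − ∫₀ᵛK_N`; ★ `(γ/T²)𝒯_N(v) = (1 − E_N) − θ_N(v)`
(g97's `oneSub_stepResponse_sub_escapeDeficit_eq_returnTail` on `escapeKernel = bathKinCorr`) and the NO-OVERSHOOT reading `0 ≤ 𝒯_N(v) ⟺ θ_N(v) ≤ 1 − E_N`;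
continuity of `𝒯_N`, `|𝒯_N| ≤ ∫_{(0,∞)}|K_N|`; `B_N(t) = γ²∫₀ᵗ𝒯_N`, `B_N(t₂) − B_N(t₁) = γ²∫_{t₁}^{t₂}𝒯_N`; ★★ `bathTailLate_eq_owedHeat`;
`bathTailLate_ge_neg_lateOvershoot`; `lateOvershoot_le_lateNegMass`; `lateOvershoot_sq_le` (Cauchy–Schwarz, no sign).
§4 (kick level): `kinKickProfile_sub_facts` (measurable + integrable on `(0,∞)`, Harris domination); `heatReturnProfile_eq_owedHeatKick`;
`heatReturnProfile_zero_sub_eq`; `bathTail_succ_eq_integral_heatReturnProfile_zero`. §4b the mechanisms with EXPLICIT hypotheses (no route statement):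
`bathTail_le_of_kickSigned` (kick-signed owed heat on `[s,∞)` ⟹ `B_N` non-decreasing there: thermal pairing of horizon increments) and
`owedHeat_nonneg_of_monotoneOn` (`B_N` non-decreasing on `[s,∞)` ⟹ `𝒯_N ≥ 0` there: continuous horizon derivative).
No `sorry`, no new axioms; nothing here is a route statement.
-/

noncomputable section

open MeasureTheory ProbabilityTheory Filter Topology Set Function
open scoped NNReal ENNReal
open Literature.MathematicalPhysics.KineticTheory.HeatConduction
open Literature.MathematicalPhysics.KineticTheory OscillatorChain
open Literature.Probability.Process
open Summit.AtomisticToContinuum.FouriersLaw.Theorems.SubdiffusiveBondHeat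
open Summit.AtomisticToContinuum.FouriersLaw.Theorems.SubdiffusiveBondHeat.EscapeGrading
open Summit.AtomisticToContinuum.FouriersLaw.Theorems.BoundedResponse.TransientBand
open Summit.AtomisticToContinuum.FouriersLaw.Theorems.BoundedResponse.ParityFloor
  (kinObs kinAct continuous_kinObs stronglyMeasurable_kinAct abs_kinAct_le harrisBound_exists weight_facts
    oneSub_stepResponse_sub_escapeDeficit_eq_returnTail)
open Summit.AtomisticToContinuum.FouriersLaw.Theorems.OddSectorIrreversibility (pinnedChain_stronglyMeasurable_act_uncurry)

namespace Summit.AtomisticToContinuum.FouriersLaw.Theorems.BoundedResponse.HeatSpreading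

open Summit.AtomisticToContinuum.FouriersLaw.Theses.BondHeatUncertainty (BoundedResponse SubdiffusiveBondHeat)

/-! ## §3 Kernel level: the owed heat, the step response, and the bath tail functional as ACCUMULATED OWED HEAT -/

section Chain

variable {ω₂ lam β γ : ℝ} {T : ℝ}

section Pos

variable (hω : 0 < ω₂) (hl : 0 < lam) (hβ : 0 < β) (hγ : 0 < γ) (hT : 0 < T)
include hω hl hβ hγ hT

/-- The kernel facts used below: `K_N` is measurable and integrable on `(0,∞)` (every `N`; `K_0 ≡ 0`). [formal bookkeeping] -/
theorem bathKinCorr_measurable_integrableOn (N : ℕ) :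
    Measurable (bathKinCorr ω₂ lam β γ T N) ∧ IntegrableOn (bathKinCorr ω₂ lam β γ T N) (Ioi 0) := by
  have e : escapeKernel ω₂ lam β γ T N = bathKinCorr ω₂ lam β γ T N := funext (escapeKernel_eq_bathKinCorr ω₂ lam β γ T N)
  rw [← e]
  exact ⟨(continuous_escapeKernel hω hl hβ hγ hT N).measurable, integrableOn_escapeKernel hω hl hβ hγ hT N⟩

/-- `𝒯_N(v) = ∫_{(0,∞)} K_N − ∫₀ᵛ K_N` for `v ≥ 0`. [formal bookkeeping] -/
theorem owedHeat_eq_sub (N : ℕ) {v : ℝ} (hv : 0 ≤ v) :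
    owedHeat ω₂ lam β γ T N v = (∫ r in Ioi 0, bathKinCorr ω₂ lam β γ T N r) - ∫ r in (0:ℝ)..v, bathKinCorr ω₂ lam β γ T N r :=
  setIntegral_Ioi_eq_sub_intervalIntegral (bathKinCorr_measurable_integrableOn hω hl hβ hγ hT N).2 hv

/-- ★ **OWED HEAT = REMAINING RISE OF THE STEP RESPONSE**: `(γ/T²)·𝒯_N(v) = (1 − E_N) − θ_N(v) = θ_N(∞) − θ_N(v)` (`v ≥ 0`). So `𝒯_N(v) ≥ 0`
says the contact temperature has not OVERSHOT its final value at lag `v`. (The g97 identity, in this node's names.) [formal bookkeeping] -/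
theorem owedHeat_eq_stepResponse_gap (N : ℕ) {v : ℝ} (hv : 0 ≤ v) :
    γ / T ^ 2 * owedHeat ω₂ lam β γ T N v = (1 - escapeDeficit ω₂ lam β γ T N) - stepResponse ω₂ lam β γ T N v := by
  have h := oneSub_stepResponse_sub_escapeDeficit_eq_returnTail hω hl hβ hγ hT N hv
  unfold owedHeat
  simp only [← escapeKernel_eq_bathKinCorr]
  linarith

/-- ★ **NO-OVERSHOOT READING**: `𝒯_N(v) ≥ 0 ⟺ θ_N(v) ≤ 1 − E_N = θ_N(∞)` (`v ≥ 0`) — the contact kinetic temperature at lag `v` after the bath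
step has not overshot its stationary value. [this cell] -/
theorem owedHeat_nonneg_iff_stepResponse_le (N : ℕ) {v : ℝ} (hv : 0 ≤ v) :
    0 ≤ owedHeat ω₂ lam β γ T N v ↔ stepResponse ω₂ lam β γ T N v ≤ 1 - escapeDeficit ω₂ lam β γ T N := by
  have h := owedHeat_eq_stepResponse_gap hω hl hβ hγ hT N hv
  have hc : 0 < γ / T ^ 2 := by positivity
  constructor
  · intro h0; nlinarith [mul_nonneg hc.le h0]
  · intro h1
    have : 0 ≤ γ / T ^ 2 * owedHeat ω₂ lam β γ T N v := by linarith
    exact (mul_nonneg_iff_of_pos_left hc).1 this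

/-- `𝒯_N` is continuous on `[0,t]`. [formal bookkeeping] -/
theorem continuousOn_owedHeat (N : ℕ) {t : ℝ} (ht : 0 ≤ t) : ContinuousOn (owedHeat ω₂ lam β γ T N) (Icc 0 t) :=
  continuousOn_setIntegral_Ioi (bathKinCorr_measurable_integrableOn hω hl hβ hγ hT N).2 ht

/-- `𝒯_N` is continuous on `[0,∞)` (the kernel is continuous, so the primitive is). [formal bookkeeping] -/
theorem continuousWithinAt_owedHeat (N : ℕ) {v : ℝ} (hv : 0 ≤ v) : ContinuousWithinAt (owedHeat ω₂ lam β γ T N) (Ici 0) v := by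
  have h := (continuousOn_owedHeat hω hl hβ hγ hT N (show (0:ℝ) ≤ v + 1 by linarith)) v ⟨hv, by linarith⟩
  refine (h.mono_of_mem_nhdsWithin ?_)
  exact mem_nhdsWithin.2 ⟨Iio (v + 1), isOpen_Iio, by simp, fun x hx => ⟨hx.2, le_of_lt hx.1⟩⟩

/-- `|𝒯_N(v)| ≤ ∫_{(0,∞)} |K_N|` for `v ≥ 0`. [formal bookkeeping] -/
theorem abs_owedHeat_le (N : ℕ) {v : ℝ} (hv : 0 ≤ v) :
    |owedHeat ω₂ lam β γ T N v| ≤ ∫ r in Ioi 0, |bathKinCorr ω₂ lam β γ T N r| := by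
  have hKi := (bathKinCorr_measurable_integrableOn hω hl hβ hγ hT N).2
  unfold owedHeat
  calc |∫ r in Ioi v, bathKinCorr ω₂ lam β γ T N r| ≤ ∫ r in Ioi v, |bathKinCorr ω₂ lam β γ T N r| := abs_integral_le_integral_abs
    _ ≤ ∫ r in Ioi 0, |bathKinCorr ω₂ lam β γ T N r| :=
        setIntegral_mono_set hKi.abs (ae_of_all _ fun r => abs_nonneg _) (ae_of_all _ (Ioi_subset_Ioi hv))

/-- Interval integrability of `𝒯_N` and of `𝒯_N⁻` on `[a,b] ⊂ [0,∞)`. [formal bookkeeping] -/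
theorem intervalIntegrable_owedHeat (N : ℕ) {a b : ℝ} (ha : 0 ≤ a) (hab : a ≤ b) :
    IntervalIntegrable (owedHeat ω₂ lam β γ T N) volume a b ∧
      IntervalIntegrable (fun v => max (-(owedHeat ω₂ lam β γ T N v)) 0) volume a b := by
  have hc : ContinuousOn (owedHeat ω₂ lam β γ T N) (Icc a b) :=
    (continuousOn_owedHeat hω hl hβ hγ hT N (ha.trans hab)).mono (Icc_subset_Icc_left ha)
  have hm : ContinuousOn (fun v => max (-(owedHeat ω₂ lam β γ T N v)) 0) (Icc a b) :=
    (continuous_neg.max continuous_const : Continuous fun x : ℝ => max (-x) 0).comp_continuousOn hc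
  exact ⟨hc.intervalIntegrable_of_Icc hab, hm.intervalIntegrable_of_Icc hab⟩

/-- ★★ **THE BATH TAIL FUNCTIONAL IS ACCUMULATED OWED HEAT**: `B_N(t) = γ² ∫₀ᵗ 𝒯_N(v) dv` (`t ≥ 0`). [this cell] -/
theorem bathTail_eq_integral_owedHeat (N : ℕ) {t : ℝ} (ht : 0 ≤ t) :
    bathTail ω₂ lam β γ T N t = γ ^ 2 * ∫ v in (0:ℝ)..t, owedHeat ω₂ lam β γ T N v := by
  obtain ⟨hKm, hKi⟩ := bathKinCorr_measurable_integrableOn hω hl hβ hγ hT N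
  unfold bathTail owedHeat
  rw [integral_min_mul_eq_intervalIntegral_tail hKm hKi ht]

/-- ★★ **HORIZON INCREMENTS OF `B_N` ARE OWED-HEAT INTEGRALS**: `B_N(t₂) − B_N(t₁) = γ² ∫_{t₁}^{t₂} 𝒯_N` (`0 ≤ t₁ ≤ t₂`) — `γ²𝒯_N` is the horizon
derivative of the bath tail functional. [this cell] -/
theorem bathTail_sub_eq (N : ℕ) {t₁ t₂ : ℝ} (h1 : 0 ≤ t₁) (h12 : t₁ ≤ t₂) :
    bathTail ω₂ lam β γ T N t₂ - bathTail ω₂ lam β γ T N t₁ = γ ^ 2 * ∫ v in t₁..t₂, owedHeat ω₂ lam β γ T N v := by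
  obtain ⟨hKm, hKi⟩ := bathKinCorr_measurable_integrableOn hω hl hβ hγ hT N
  unfold bathTail owedHeat
  rw [← mul_sub, integral_min_sub_min_mul_eq hKm hKi h1 h12]

/-- ★★ **THE LATE FUNCTIONAL IS LATE OWED HEAT**: for `0 ≤ s`, `2s ≤ t`,
`B^late_N(s,t) = γ²·(∫_{2s}^{t} 𝒯_N + 2∫_{s}^{2s} 𝒯_N)` — NODE 109's residual functional reads the owed heat on `[s,t]` ONLY, with density `≤ 2`.
[this cell] -/
theorem bathTailLate_eq_owedHeat {N : ℕ} (hN : 0 < N) {s t : ℝ} (hs : 0 ≤ s) (hst : 2 * s ≤ t) :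
    bathTailLate ω₂ lam β γ T N s t =
      γ ^ 2 * ((∫ v in (2 * s)..t, owedHeat ω₂ lam β γ T N v) + 2 * ∫ v in s..(2 * s), owedHeat ω₂ lam β γ T N v) := by
  obtain ⟨hKm, hKi⟩ := bathKinCorr_measurable_integrableOn hω hl hβ hγ hT N
  rw [bathTailLate_eq_integral hω hl hβ hγ hT hN hs (by linarith), integral_lateWeight_mul_eq hKm hKi hs hst]
  rfl

/-- ★ **LATE FLOOR FROM LATE OVERSHOOT, one `N` at a time**: `B^late_N(s,t) ≥ −2γ²·𝒪_N(s,t)` (`0 ≤ s`, `2s ≤ t`). [this cell] -/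
theorem bathTailLate_ge_neg_lateOvershoot {N : ℕ} (hN : 0 < N) {s t : ℝ} (hs : 0 ≤ s) (hst : 2 * s ≤ t) :
    -(2 * γ ^ 2 * lateOvershoot ω₂ lam β γ T N s t) ≤ bathTailLate ω₂ lam β γ T N s t := by
  have h2s : s ≤ 2 * s := by linarith
  have ht : 2 * s ≤ t := hst
  rw [bathTailLate_eq_owedHeat hω hl hβ hγ hT hN hs hst]
  unfold lateOvershoot
  set F := owedHeat ω₂ lam β γ T N with hF
  set Fm : ℝ → ℝ := fun v => max (-(F v)) 0 with hFm
  have hpt : ∀ v, -(Fm v) ≤ F v := fun v => by simp only [hFm]; have := le_max_left (-(F v)) 0; linarith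
  have hFm0 : ∀ v, 0 ≤ Fm v := fun v => le_max_right _ _
  obtain ⟨hI1, hI1m⟩ := intervalIntegrable_owedHeat hω hl hβ hγ hT N (by positivity : (0:ℝ) ≤ 2 * s) ht
  obtain ⟨hI2, hI2m⟩ := intervalIntegrable_owedHeat hω hl hβ hγ hT N hs h2s
  have hA : -(∫ v in (2 * s)..t, Fm v) ≤ ∫ v in (2 * s)..t, F v := by
    rw [← intervalIntegral.integral_neg]
    exact intervalIntegral.integral_mono_on ht hI1m.neg hI1 (fun v _ => hpt v)
  have hB : -(∫ v in s..(2 * s), Fm v) ≤ ∫ v in s..(2 * s), F v := by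
    rw [← intervalIntegral.integral_neg]
    exact intervalIntegral.integral_mono_on h2s hI2m.neg hI2 (fun v _ => hpt v)
  have hsplit : ∫ v in s..t, Fm v = (∫ v in s..(2 * s), Fm v) + ∫ v in (2 * s)..t, Fm v :=
    (intervalIntegral.integral_add_adjacent_intervals hI2m hI1m).symm
  have hA0 : 0 ≤ ∫ v in (2 * s)..t, Fm v := intervalIntegral.integral_nonneg ht (fun v _ => hFm0 v)
  have hγ2 : 0 ≤ γ ^ 2 := by positivity
  rw [hsplit]
  nlinarith [mul_le_mul_of_nonneg_left (add_le_add hA (mul_le_mul_of_nonneg_left hB (by norm_num : (0:ℝ) ≤ 2))) hγ2]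

/-- ★ **LATE OVERSHOOT ≤ LATE NEGATIVE MASS**: `𝒪_N(s,t) ≤ 𝔐_N(s,t)` (`0 ≤ s ≤ t`; `𝒯⁻(v) ≤ ∫_{(v,∞)} K⁻`, then the layer cake for `K⁻`).
[this cell] -/
theorem lateOvershoot_le_lateNegMass (N : ℕ) {s t : ℝ} (hs : 0 ≤ s) (hst : s ≤ t) :
    lateOvershoot ω₂ lam β γ T N s t ≤ lateNegMass ω₂ lam β γ T N s t := by
  obtain ⟨hKm, hKi⟩ := bathKinCorr_measurable_integrableOn hω hl hβ hγ hT N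
  set Km : ℝ → ℝ := fun r => max (-(bathKinCorr ω₂ lam β γ T N r)) 0 with hKmdef
  have hKmm : Measurable Km := hKm.neg.max measurable_const
  have hKm0 : ∀ r, 0 ≤ Km r := fun r => le_max_right _ _
  have hKmi : IntegrableOn Km (Ioi 0) := by
    refine Integrable.mono' hKi.abs hKmm.aestronglyMeasurable (ae_of_all _ fun r => ?_)
    rw [Real.norm_eq_abs, abs_of_nonneg (hKm0 r)]
    exact max_le (neg_le_abs _) (abs_nonneg _)
  -- pointwise `𝒯⁻(v) ≤ ∫_{(v,∞)} K⁻`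
  have hpt : ∀ v, 0 ≤ v → max (-(owedHeat ω₂ lam β γ T N v)) 0 ≤ ∫ r in Ioi v, Km r := fun v hv => by
    refine max_le ?_ (setIntegral_nonneg measurableSet_Ioi fun r _ => hKm0 r)
    unfold owedHeat
    rw [← integral_neg]
    exact setIntegral_mono_on (hKi.mono_set (Ioi_subset_Ioi hv)).neg (hKmi.mono_set (Ioi_subset_Ioi hv)) measurableSet_Ioi
      (fun r _ => le_max_left _ _)
  have ht : 0 ≤ t := hs.trans hst
  calc lateOvershoot ω₂ lam β γ T N s t ≤ ∫ v in s..t, ∫ r in Ioi v, Km r := by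
        unfold lateOvershoot
        exact intervalIntegral.integral_mono_on hst (intervalIntegrable_owedHeat hω hl hβ hγ hT N hs hst).2
          (intervalIntegrable_setIntegral_Ioi hKmi hs hst le_rfl) (fun v hv => hpt v (hs.trans hv.1))
    _ ≤ ∫ r in Ioi s, min r t * Km r := intervalIntegral_tail_le_integral_min_mul hKmm hKmi hKm0 hs hst
    _ = lateNegMass ω₂ lam β γ T N s t := rfl

/-- ★ **LATE OVERSHOOT BY THE SQUARE BUDGET, NO SIGN**: `𝒪_N(s,t)² ≤ (t − s)·∫ₛᵗ 𝒯_N(v)² dv` (`0 ≤ s ≤ t`; Cauchy–Schwarz on the window —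
cited: `Literature.Analysis.FunctionSpaces.sq_intervalIntegral_le` [folklore] — and `(𝒯⁻)² ≤ 𝒯²`). [this cell] -/
theorem lateOvershoot_sq_le (N : ℕ) {s t : ℝ} (hs : 0 ≤ s) (hst : s ≤ t) :
    lateOvershoot ω₂ lam β γ T N s t ^ 2 ≤ (t - s) * ∫ v in s..t, owedHeat ω₂ lam β γ T N v ^ 2 := by
  have hc : ContinuousOn (owedHeat ω₂ lam β γ T N) (uIcc s t) := by
    rw [uIcc_of_le hst]
    exact (continuousOn_owedHeat hω hl hβ hγ hT N (hs.trans hst)).mono (Icc_subset_Icc_left hs)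
  have hm : ContinuousOn (fun v => max (-(owedHeat ω₂ lam β γ T N v)) 0) (uIcc s t) :=
    (continuous_neg.max continuous_const : Continuous fun x : ℝ => max (-x) 0).comp_continuousOn hc
  have h1 := Literature.Analysis.FunctionSpaces.sq_intervalIntegral_le hst hm.intervalIntegrable (hm.pow 2).intervalIntegrable
  have h2 : ∫ v in s..t, (max (-(owedHeat ω₂ lam β γ T N v)) 0) ^ 2 ≤ ∫ v in s..t, owedHeat ω₂ lam β γ T N v ^ 2 :=
    intervalIntegral.integral_mono_on hst (hm.pow 2).intervalIntegrable (hc.pow 2).intervalIntegrable fun v _ => by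
      rcases le_total 0 (owedHeat ω₂ lam β γ T N v) with h | h
      · rw [max_eq_right (by linarith : -owedHeat ω₂ lam β γ T N v ≤ 0)]
        exact le_of_eq_of_le (by norm_num) (sq_nonneg _)
      · rw [max_eq_left (by linarith : (0:ℝ) ≤ -owedHeat ω₂ lam β γ T N v)]
        exact (neg_sq _).le
  unfold lateOvershoot
  exact h1.trans (mul_le_mul_of_nonneg_left h2 (sub_nonneg.2 hst))

/-! ## §4 Kick level: the kick-resolved owed heat and NODE 111's heat-return curve as its late integral -/

/-- `u ↦ Ḡ_{n+1,u}(k) − T` is measurable and integrable on `(0,∞)` (dominated by `K(2/ϑ+T)e^{ϑk²/2}(∫e^{ϑH}dμ_T)·e^{−cu}`, the tree's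
domination for `integrableOn_lateWeight_mul_kinKickProfile_sub` with the weight removed). [folklore] -/
theorem kinKickProfile_sub_facts (n : ℕ) (k : ℝ) :
    Measurable (fun u : ℝ => kinKickProfile ω₂ lam β γ T (n + 1) u k - T) ∧
      IntegrableOn (fun u : ℝ => kinKickProfile ω₂ lam β γ T (n + 1) u k - T) (Ioi 0) := by
  obtain ⟨hϑ0, -, hϑ1⟩ := weight_facts hT
  set ϑ : ℝ := 1 / (4 * T) with hϑ
  haveI := pinnedChain_isProbabilityMeasure_gibbsMeasure hω hl.le hβ.le γ (n + 1) hT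
  obtain ⟨K, c, hK0, hc, hb⟩ := harrisBound_exists hω hl.le hβ hγ (Nat.succ_pos n) hT hϑ0 hϑ1
  have hrepr : ∀ u : ℝ, kinKickProfile ω₂ lam β γ T (n + 1) u k - T =
      ∫ z : PhaseSpace (n + 1), kinAct ω₂ lam β γ T (n + 1) 0 u ((z.1, Function.update z.2 0 k) : PhaseSpace (n + 1))
        ∂((pinnedChain ω₂ lam β γ).gibbsMeasure (n + 1) T) := fun u => by
    rw [← kickAvg_kinAct_eq hω hl hβ hγ hT n u k]; rfl
  have h1 := (pinnedChain_stronglyMeasurable_act_uncurry hω hl.le hβ.le hγ.le T T (N := n + 1)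
    (continuous_kinObs T (0 : Fin (n + 1))).measurable).comp_measurable
    (measurable_fst.prodMk ((measurable_kickMomentum n k).comp measurable_snd) :
      Measurable fun q : ℝ × PhaseSpace (n + 1) => (q.1, ((q.2.1, Function.update q.2.2 0 k) : PhaseSpace (n + 1))))
  have hGm : StronglyMeasurable fun u : ℝ => kinKickProfile ω₂ lam β γ T (n + 1) u k - T := by
    have h3 := StronglyMeasurable.integral_prod_right' (ν := (pinnedChain ω₂ lam β γ).gibbsMeasure (n + 1) T) h1
    have e : (fun u : ℝ => kinKickProfile ω₂ lam β γ T (n + 1) u k - T) = fun u : ℝ =>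
        ∫ z : PhaseSpace (n + 1), ((fun q : ℝ × PhaseSpace (n + 1) =>
          ∫ y, kinObs T (n + 1) 0 y ∂((pinnedChain ω₂ lam β γ).transitionKernel (n + 1) T T q.1.toNNReal q.2)) ∘
          (fun q : ℝ × PhaseSpace (n + 1) => (q.1, ((q.2.1, Function.update q.2.2 0 k) : PhaseSpace (n + 1))))) (u, z)
          ∂((pinnedChain ω₂ lam β γ).gibbsMeasure (n + 1) T) := by
      funext u
      rw [hrepr u]
      rfl
    rw [e]
    exact h3
  set I := ∫ z, Real.exp (ϑ * (pinnedChain ω₂ lam β γ).hamiltonian (n + 1) z) ∂((pinnedChain ω₂ lam β γ).gibbsMeasure (n + 1) T) with hI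
  set M := K * (2 / ϑ + T) * Real.exp (ϑ * (k ^ 2 / 2)) * I with hM
  have hdecay : IntegrableOn (fun u : ℝ => M * Real.exp (-c * u)) (Ioi 0) := (exp_neg_integrableOn_Ioi 0 hc).const_mul _
  refine ⟨hGm.measurable, hdecay.mono' hGm.aestronglyMeasurable.restrict ?_⟩
  refine (ae_restrict_iff' measurableSet_Ioi).2 (Eventually.of_forall fun u hu => ?_)
  have hu0 : 0 ≤ u := le_of_lt (show (0:ℝ) < u from hu)
  rw [Real.norm_eq_abs, hrepr u]
  have hkick := (integrable_kick_of_abs_le hω hl hβ hT hϑ0.le hϑ1 (stronglyMeasurable_kinAct ω₂ lam β γ T 0 u)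
    (C := K * (2 / ϑ + T) * Real.exp (-c * (u.toNNReal : ℝ)))
    (fun y => (abs_kinAct_le hω hl.le hβ.le hT hϑ0 hb 0 u y).trans_eq (by ring)) k).2
  rw [Real.coe_toNNReal _ hu0] at hkick
  calc |∫ z : PhaseSpace (n + 1), kinAct ω₂ lam β γ T (n + 1) 0 u ((z.1, Function.update z.2 0 k) : PhaseSpace (n + 1))
          ∂((pinnedChain ω₂ lam β γ).gibbsMeasure (n + 1) T)|
      ≤ K * (2 / ϑ + T) * Real.exp (-c * u) * Real.exp (ϑ * (k ^ 2 / 2)) * I := (abs_integral_le_integral_abs).trans hkick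
    _ = M * Real.exp (-c * u) := by rw [hM]; ring

/-- ★★ **THE HEAT-RETURN CURVE IS LATE OWED HEAT, KICK BY KICK**: for `0 ≤ s`, `2s ≤ t` and every kick `k`,
`𝔊^{s,t}_N(k) = ∫_{2s}^{t} 𝔗^v_N(k) dv + 2∫_{s}^{2s} 𝔗^v_N(k) dv` (NODE 111's `𝔊 = ∫ ℓ (Ḡ − T)` and the late layer cake). [this cell] -/
theorem heatReturnProfile_eq_owedHeatKick (n : ℕ) {s t : ℝ} (hs : 0 ≤ s) (hst : 2 * s ≤ t) (k : ℝ) :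
    heatReturnProfile ω₂ lam β γ T (n + 1) s t k =
      (∫ v in (2 * s)..t, owedHeatKick ω₂ lam β γ T (n + 1) v k) + 2 * ∫ v in s..(2 * s), owedHeatKick ω₂ lam β γ T (n + 1) v k := by
  obtain ⟨hgm, hgi⟩ := kinKickProfile_sub_facts hω hl hβ hγ hT n k
  rw [heatReturnProfile_eq_setIntegral hω hl hβ hγ hT n s t k, integral_lateWeight_mul_eq hgm hgi hs hst]
  rfl

/-- NODE 110's heat-deficit curve as accumulated kick-resolved owed heat: `𝔊^{0,τ}_N(k) = ∫₀^τ 𝔗^v_N(k) dv`, hence the HORIZON INCREMENT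
`𝔊^{0,t₂}_N(k) − 𝔊^{0,t₁}_N(k) = ∫_{t₁}^{t₂} 𝔗^v_N(k) dv` (`0 ≤ t₁ ≤ t₂`). [this cell] -/
theorem heatReturnProfile_zero_sub_eq (n : ℕ) {t₁ t₂ : ℝ} (h1 : 0 ≤ t₁) (h12 : t₁ ≤ t₂) (k : ℝ) :
    heatReturnProfile ω₂ lam β γ T (n + 1) 0 t₂ k - heatReturnProfile ω₂ lam β γ T (n + 1) 0 t₁ k =
      ∫ v in t₁..t₂, owedHeatKick ω₂ lam β γ T (n + 1) v k := by
  obtain ⟨hgm, hgi⟩ := kinKickProfile_sub_facts hω hl hβ hγ hT n k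
  have e : ∀ τ : ℝ, heatReturnProfile ω₂ lam β γ T (n + 1) 0 τ k = ∫ u in Ioi 0, min u τ * (kinKickProfile ω₂ lam β γ T (n + 1) u k - T) :=
    fun τ => by
    rw [heatReturnProfile_eq_setIntegral hω hl hβ hγ hT n 0 τ k]
    refine setIntegral_congr_fun measurableSet_Ioi (fun u hu => ?_)
    show lateWeight 0 τ u * _ = min u τ * _
    rw [show lateWeight 0 τ u = min u τ by
      unfold lateWeight; rw [mul_zero, min_eq_right (le_of_lt (show (0:ℝ) < u from hu))]; ring]
  rw [e, e, integral_min_sub_min_mul_eq hgm hgi h1 h12]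
  rfl

/-- `B_{n+1}(t) = γ² ∫ θ_T(k)·𝔊^{0,t}_{n+1}(k) dν_T(k)` with `θ_T·𝔊^{0,t} ∈ L¹(ν_T)` (`t ≥ 0`; NODE 111 at `s = 0`). [formal bookkeeping] -/
theorem bathTail_succ_eq_integral_heatReturnProfile_zero (n : ℕ) {t : ℝ} (ht : 0 ≤ t) :
    Integrable (fun k : ℝ => (k ^ 2 - T) * heatReturnProfile ω₂ lam β γ T (n + 1) 0 t k) (gaussianReal 0 T.toNNReal) ∧
      bathTail ω₂ lam β γ T (n + 1) t = γ ^ 2 * ∫ k, (k ^ 2 - T) * heatReturnProfile ω₂ lam β γ T (n + 1) 0 t k ∂(gaussianReal 0 T.toNNReal) := by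
  rw [← bathTailLate_zero_left]
  exact bathTailLate_eq_integral_heatReturnProfile hω hl hβ hγ hT n le_rfl ht

/-! ### §4b The two mechanisms of the tail-cumulative axis (hypotheses explicit; no route statement involved) -/

/-- The kick-level mechanism: if `(k²−T)𝔗^v_N(k) ≥ 0` for all `v ≥ s` (`s ≥ 0`), then for `s ≤ t₁ ≤ t₂` the thermal pairing
`(k²−T)(𝔊^{0,t₂}_N(k) − 𝔊^{0,t₁}_N(k)) ≥ 0`, hence `B_N(t₁) ≤ B_N(t₂)`. [this cell] -/
theorem bathTail_le_of_kickSigned (n : ℕ) {s : ℝ} (hs : 0 ≤ s)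
    (hsign : ∀ v : ℝ, s ≤ v → ∀ k : ℝ, 0 ≤ (k ^ 2 - T) * owedHeatKick ω₂ lam β γ T (n + 1) v k)
    {t₁ t₂ : ℝ} (h1 : s ≤ t₁) (h12 : t₁ ≤ t₂) :
    bathTail ω₂ lam β γ T (n + 1) t₁ ≤ bathTail ω₂ lam β γ T (n + 1) t₂ := by
  have h01 : 0 ≤ t₁ := hs.trans h1
  obtain ⟨hI1, e1⟩ := bathTail_succ_eq_integral_heatReturnProfile_zero hω hl hβ hγ hT n h01
  obtain ⟨hI2, e2⟩ := bathTail_succ_eq_integral_heatReturnProfile_zero hω hl hβ hγ hT n (h01.trans h12)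
  have hpt : ∀ k : ℝ, 0 ≤ (k ^ 2 - T) * heatReturnProfile ω₂ lam β γ T (n + 1) 0 t₂ k -
      (k ^ 2 - T) * heatReturnProfile ω₂ lam β γ T (n + 1) 0 t₁ k := fun k => by
    rw [← mul_sub, heatReturnProfile_zero_sub_eq hω hl hβ hγ hT n h01 h12 k, ← intervalIntegral.integral_const_mul]
    exact intervalIntegral.integral_nonneg h12 fun v hv => hsign v (h1.trans hv.1) k
  have hdiff : 0 ≤ (∫ k, (k ^ 2 - T) * heatReturnProfile ω₂ lam β γ T (n + 1) 0 t₂ k ∂(gaussianReal 0 T.toNNReal)) -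
      ∫ k, (k ^ 2 - T) * heatReturnProfile ω₂ lam β γ T (n + 1) 0 t₁ k ∂(gaussianReal 0 T.toNNReal) := by
    rw [← integral_sub hI2 hI1]
    exact integral_nonneg hpt
  have hγ2 : 0 ≤ γ ^ 2 := by positivity
  rw [e1, e2]
  nlinarith [mul_nonneg hγ2 hdiff]

/-- The kernel-level mechanism: if `B_N` is non-decreasing on `[s,∞)` (`s ≥ 0`), then `𝒯_N(v) ≥ 0` for every `v ≥ s` — `γ²𝒯_N` is the
(continuous) horizon derivative of `B_N`. [this cell] -/
theorem owedHeat_nonneg_of_monotoneOn (N : ℕ) {s : ℝ} (hs : 0 ≤ s) (hmono : MonotoneOn (bathTail ω₂ lam β γ T N) (Ici s))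
    {v : ℝ} (hv : s ≤ v) : 0 ≤ owedHeat ω₂ lam β γ T N v := by
  have hv0 : 0 ≤ v := hs.trans hv
  by_contra hneg
  rw [not_le] at hneg
  obtain ⟨δ, hδ, hδF⟩ := Metric.continuousWithinAt_iff.1 (continuousWithinAt_owedHeat hω hl hβ hγ hT N hv0)
    (-(owedHeat ω₂ lam β γ T N v) / 2) (by linarith)
  have hle : v ≤ v + δ / 2 := by linarith
  have hlt : ∀ x ∈ Icc v (v + δ / 2), owedHeat ω₂ lam β γ T N x ≤ owedHeat ω₂ lam β γ T N v / 2 := fun x hx => by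
    have hx0 : x ∈ Ici (0:ℝ) := show (0:ℝ) ≤ x from hv0.trans hx.1
    have hd : dist x v < δ := by
      rw [Real.dist_eq, abs_of_nonneg (by linarith [hx.1])]; linarith [hx.2]
    have h := hδF hx0 hd
    rw [Real.dist_eq] at h
    linarith [(abs_lt.1 h).2]
  have hint := bathTail_sub_eq hω hl hβ hγ hT N hv0 hle
  have hI := (intervalIntegrable_owedHeat hω hl hβ hγ hT N hv0 hle).1
  have hbound : ∫ x in v..(v + δ / 2), owedHeat ω₂ lam β γ T N x ≤ ∫ _x in v..(v + δ / 2), owedHeat ω₂ lam β γ T N v / 2 :=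
    intervalIntegral.integral_mono_on hle hI intervalIntegrable_const (fun x hx => hlt x hx)
  rw [intervalIntegral.integral_const, smul_eq_mul] at hbound
  have hm := hmono (show s ≤ v from hv) (show s ≤ v + δ / 2 from hv.trans hle) hle
  have hγ2 : 0 < γ ^ 2 := by positivity
  have hneg' : (v + δ / 2 - v) * (owedHeat ω₂ lam β γ T N v / 2) < 0 := by nlinarith
  nlinarith [mul_lt_mul_of_pos_left (lt_of_le_of_lt hbound hneg') hγ2]

end Pos

end Chain

end Summit.AtomisticToContinuum.FouriersLaw.Theorems.BoundedResponse.HeatSpreading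

end
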